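import Summits.PneNP.PneNP.Theorems.ChebyshevTracialDesignScalarTiltFixedDirection
import HarnessLib

/-!
# Cell pnp-psdrank, route `ChebyshevTracialDesign`: SCALAR TILTS OF A FIXED DIRECTION — the (CG_1′) form with every mask and the
# UNCONDITIONAL decay for the crux's designs (brick 170b; crux `TracialDecayExp20`, stmt-PneNP-19878)

Brick 170b (prover g33; MEMO-36 §1), companion of brick 170 (`…ScalarTiltFixedDirection`: for an exact design on the `t = 2c'+1`-cuts with
`4 ≤ D ≤ 2c'` and all-rectangle bound `γ`, every FIXED direction `|u| ≤ 1` tilted by an ARBITRARY scalar `|h(M)| ≤ 1` has total positive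
per-cut containment value `Σ_U (Σ_M W(U,M) C_{h(M)u}(U)²)₊ ≤ n²γ + 3n⁴·(Σ|w_c|)·√P_{D−4}`, and a finite direction menu costs `|κ|×`).
Notation as there: `x_p = 1[p ∈ U]`, `π_M` the partner map, `C_v(U) := Σ_p v_p x_p x_{π_M p}`.
* §1 **`sum_posPart_perM_scalarTilt_le`** — the (CG_1′) form for EVERY mask `0 ≤ f ≤ G`:
  `Σ_M (Σ_U W(U,M) f(U) C_{h(M)u}(U)²)₊ ≤ G·(n²γ + 3n⁴·(Σ|w_c|)·√P_{D−4})` (drop the tilt `h² ≤ 1` per matching; the positive parts over `M`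
  of the untilted direction are attained by the selector tilt `1[per-M value > 0]·u`, a scalar tilt; swap the sums, bound the mask by `G`).
* §2 design corollaries, UNCONDITIONAL for the crux's balanced Chebyshev designs (`IsBalancedDesign n t (Tq n) (dq n) 20 C w`; `γ = 20e^{−a·dq n}`
  by the `r = 1` rung `…UnconditionalRungs.rectangleDecayExp_all_holds`, `Σ|w| ≤ 20`, `n ≥ 256` absorbed in `n₁`): **`scalarTilt_perCut_decay`**
  (`Σ_U (Σ_M W C_{h(M)u}²)₊ ≤ n²·20e^{−a·dq n} + 3n⁴·20√P_{dq n−4}` — in particular MEMO-35 §4's «tilted NTF» instance `h = 1_𝓜`, `u = 1_A − 1_B`),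
  **`menu_perCut_decay`** (`v_M = c(M)·u^{ι(M)}`, `ι : PM → Fin N`: `N×`), **`scalarTilt_perM_decay`** (the (CG_1′) form, every mask `0 ≤ f ≤ G`).
READING (MEMO-36 §1–2): MEMO-35 §4's named «smallest open instance» is priced; its toy-scale positive per-cut mass (MEMO-35 §8, n ≤ 20, D ≤ 3) is
the crossing-form remainder `3n⁴β` of brick 101, which is vacuous below `D = 4`. The open residue of the M-dependence axis needs directions
ROTATING with `M` through `e^{Ω(dq n)}` positions. [cite: Rothvoss2017, §2 and Lemma 7 (PDF pp. 6–8)] [cite: KeevashLifshitz2023, Thm. 1.8]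
[cite: Grigoriev2001, Lemma 1.4 (PDF p. 8)] [cite: GriblingDelaatLaurent2019, §5]
Stature: support/instrument (kernel lane, no defs, axioms standard). WHAT THIS IS NOT: not (PC) for `M`-rotating directions, no proof or
refutation of `TracialDecayExp20`, nothing on psd rank of P_PM(K_n) beyond the rungs, no P-vs-NP content. Supports stmt-PneNP-19878.
-/

set_option linter.dupNamespace false -- `Summit.PneNP.PneNP.…`: summit = sub-problem (D-0017)

noncomputable section

namespace Summit.PneNP.PneNP.Theorems.ChebyshevTracialDesignScalarTiltFixedDirectionDecay

open Finset Literature.Barriers.PneNP Literature.Combinatorics.Optimization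
open Summit.PneNP.PneNP.Theorems.ChebyshevTracialDesignScalarTiltFixedDirection
  (perCut_posPart_scalarTilt_le perCut_posPart_menu_le)
open Summit.PneNP.PneNP.Theorems.ChebyshevTracialDesignUnconditionalRungs (rectangleDecayExp_all_holds)

variable {n : ℕ}

/-! ### §1 The (CG_1′) form with every mask -/

/-- **(CG_1′) FOR SCALAR TILTS OF A FIXED DIRECTION, EVERY MASK.** Same setting; for every mask `0 ≤ f ≤ G`, every fixed `|u| ≤ 1` and every
scalar `|h| ≤ 1`: `Σ_M (Σ_U W(U,M) f(U) C_{h(M)u}(U)²)₊ ≤ G·(n²γ + 3n⁴·(Σ|w_c|)·√P_{D−4})` (the positive parts over `M` are attained by the scalar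
tilt `1[per-M value > 0]·u`; swap the sums and bound the mask by `G` on the cuts with positive value).
[cite: Rothvoss2017, §2 and Lemma 7 (PDF pp. 6–8)] [cite: Grigoriev2001, Lemma 1.4 (PDF p. 8)] [cite: GriblingDelaatLaurent2019, §5] -/
theorem sum_posPart_perM_scalarTilt_le {c' T D : ℕ} {Bv : ℝ} {C : Finset ℕ} {w : ℕ → ℝ} (hn : Even n)
    (hdes : IsExactDesign n (2 * c' + 1) T D Bv C w) (hD : D ≤ 2 * c') (hD4 : 4 ≤ D) {γ : ℝ}
    (hR : ∀ (A : Finset (OddSet n)) (B : Finset (PMatch n)), ∑ U ∈ A, ∑ M ∈ B, levelWeight n (2 * c' + 1) C w U M ≤ γ)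
    (f : OddSet n → ℝ) {G : ℝ} (hG : 0 ≤ G) (hf0 : ∀ U, 0 ≤ f U) (hfG : ∀ U, f U ≤ G)
    (u : Fin n → ℝ) (hu : ∀ p, |u p| ≤ 1) (h : PMatch n → ℝ) (hh : ∀ M, |h M| ≤ 1) :
    ∑ M : PMatch n, max (∑ U : OddSet n, levelWeight n (2 * c' + 1) C w U M *
        (f U * (∑ p, (h M * u p) * ((if p ∈ U.1 then (1 : ℝ) else 0) * (if M.2.partner p ∈ U.1 then (1 : ℝ) else 0))) ^ 2)) 0 ≤
      G * ((n : ℝ) ^ 2 * γ +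
        3 * (n : ℝ) ^ 4 * ((∑ c ∈ C, |w c|) * Real.sqrt (∏ i ∈ range ((D - 4) / 2 + 1), ((2 * i + 1 : ℝ) / ((n : ℝ) - 2 * i))))) := by
  classical
  set W := levelWeight n (2 * c' + 1) C w with hW
  -- the per-matching value of the UNTILTED fixed direction with the mask
  set q : PMatch n → ℝ := fun M => ∑ U : OddSet n, W U M *
      (f U * (∑ p, u p * ((if p ∈ U.1 then (1 : ℝ) else 0) * (if M.2.partner p ∈ U.1 then (1 : ℝ) else 0))) ^ 2) with hq
  have hCh : ∀ (M : PMatch n) (U : OddSet n),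
      ∑ p, (h M * u p) * ((if p ∈ U.1 then (1 : ℝ) else 0) * (if M.2.partner p ∈ U.1 then (1 : ℝ) else 0)) =
        h M * ∑ p, u p * ((if p ∈ U.1 then (1 : ℝ) else 0) * (if M.2.partner p ∈ U.1 then (1 : ℝ) else 0)) := by
    intro M U
    rw [mul_sum]
    exact sum_congr rfl fun p _ => by ring
  have htilt : ∀ M : PMatch n, ∑ U : OddSet n, W U M *
      (f U * (∑ p, (h M * u p) * ((if p ∈ U.1 then (1 : ℝ) else 0) * (if M.2.partner p ∈ U.1 then (1 : ℝ) else 0))) ^ 2) =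
      h M ^ 2 * q M := by
    intro M
    simp_rw [hCh M]
    rw [hq, mul_sum]
    exact sum_congr rfl fun U _ => by ring
  have hh2 : ∀ M, 0 ≤ h M ^ 2 ∧ h M ^ 2 ≤ 1 := fun M =>
    ⟨sq_nonneg _, (sq_le_one_iff_abs_le_one _).2 (hh M)⟩
  -- step 1: drop the tilt
  have hstep1 : ∀ M : PMatch n, max (h M ^ 2 * q M) 0 ≤ max (q M) 0 := fun M => by
    refine max_le ?_ (le_max_right _ _)
    rcases le_or_gt 0 (q M) with hq0 | hq0
    · exact (mul_le_of_le_one_left hq0 (hh2 M).2).trans (le_max_left _ _)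
    · exact (mul_nonpos_iff.2 (Or.inl ⟨(hh2 M).1, hq0.le⟩)).trans (le_max_right _ _)
  -- step 2: positive parts over `M` are attained by the selector tilt `s = 1[q > 0]`
  set s : PMatch n → ℝ := fun M => if 0 < q M then (1 : ℝ) else 0 with hs
  have hs1 : ∀ M, |s M| ≤ 1 := fun M => by rw [hs]; dsimp only; split_ifs <;> simp
  have hsq : ∀ M, max (q M) 0 = s M * q M := fun M => by
    rw [hs]; dsimp only
    by_cases hpos : 0 < q M
    · rw [if_pos hpos, one_mul, max_eq_left hpos.le]
    · rw [if_neg hpos, zero_mul, max_eq_right (not_lt.1 hpos)]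
  have hssq : ∀ M, s M ^ 2 = s M := fun M => by rw [hs]; dsimp only; split_ifs <;> norm_num
  -- per-cut values of the selector-tilted field
  set g : OddSet n → ℝ := fun U => ∑ M : PMatch n, W U M *
      (∑ p, (s M * u p) * ((if p ∈ U.1 then (1 : ℝ) else 0) * (if M.2.partner p ∈ U.1 then (1 : ℝ) else 0))) ^ 2 with hg
  have hCs : ∀ (M : PMatch n) (U : OddSet n),
      ∑ p, (s M * u p) * ((if p ∈ U.1 then (1 : ℝ) else 0) * (if M.2.partner p ∈ U.1 then (1 : ℝ) else 0)) =
        s M * ∑ p, u p * ((if p ∈ U.1 then (1 : ℝ) else 0) * (if M.2.partner p ∈ U.1 then (1 : ℝ) else 0)) := by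
    intro M U
    rw [mul_sum]
    exact sum_congr rfl fun p _ => by ring
  have hswap : ∑ M : PMatch n, s M * q M = ∑ U : OddSet n, f U * g U := by
    have : ∀ M : PMatch n, s M * q M = ∑ U : OddSet n, f U * (W U M *
        (∑ p, (s M * u p) * ((if p ∈ U.1 then (1 : ℝ) else 0) * (if M.2.partner p ∈ U.1 then (1 : ℝ) else 0))) ^ 2) := by
      intro M
      rw [hq, mul_sum]
      refine sum_congr rfl fun U _ => ?_
      rw [hCs M U, mul_pow, hssq]
      ring
    simp_rw [this]
    rw [sum_comm]
    refine sum_congr rfl fun U _ => ?_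
    rw [hg, mul_sum]
  have hPC := perCut_posPart_scalarTilt_le hn hdes hD hD4 hR u hu s hs1
  calc ∑ M : PMatch n, max (∑ U : OddSet n, W U M *
          (f U * (∑ p, (h M * u p) * ((if p ∈ U.1 then (1 : ℝ) else 0) * (if M.2.partner p ∈ U.1 then (1 : ℝ) else 0))) ^ 2)) 0
      = ∑ M, max (h M ^ 2 * q M) 0 := sum_congr rfl fun M _ => by rw [htilt]
    _ ≤ ∑ M, max (q M) 0 := sum_le_sum fun M _ => hstep1 M
    _ = ∑ M, s M * q M := sum_congr rfl fun M _ => hsq M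
    _ = ∑ U, f U * g U := hswap
    _ ≤ ∑ U, G * max (g U) 0 := sum_le_sum fun U _ => by
        calc f U * g U ≤ f U * max (g U) 0 := mul_le_mul_of_nonneg_left (le_max_left _ _) (hf0 U)
          _ ≤ G * max (g U) 0 := mul_le_mul_of_nonneg_right (hfG U) (le_max_right _ _)
    _ = G * ∑ U, max (g U) 0 := by rw [mul_sum]
    _ ≤ _ := mul_le_mul_of_nonneg_left hPC hG

/-! ### §2 Design corollaries: the crux's balanced Chebyshev designs (unconditional, `γ = 20·e^{−a·dq n}`) -/

/-- `4 ≤ dq n` once `n ≥ 256`, and `dq n ≤ 2c'` when `Tq n ≤ 2c'+1`. [cite: CoppersmithRivlin1992, Thm. (p. 970)] -/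
theorem dq_bounds {n c' : ℕ} (hn : 256 ≤ n) (hT : Tq n ≤ 2 * c' + 1) : 4 ≤ dq n ∧ dq n ≤ 2 * c' := by
  refine ⟨?_, ?_⟩
  · unfold dq
    exact Nat.le_sqrt.2 (Nat.le_sqrt.2 (by omega))
  · have h1 : dq n ≤ Nat.sqrt n := Nat.sqrt_le_self _
    unfold Tq at hT
    omega

/-- **SCALAR TILTS OF A FIXED DIRECTION — UNCONDITIONAL DECAY for the crux's designs.** For some `a > 0` and all large even `n`: every balanced
exact design of degree `dq n` on levels `≤ Tq n` with `Σ|w| ≤ 20`, every fixed `|u| ≤ 1`, every scalar `|h(M)| ≤ 1`: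
`Σ_U (Σ_M W(U,M) C_{h(M)u}(U)²)₊ ≤ n²·20e^{−a·dq n} + 3n⁴·20·√P_{dq n−4}`. In particular the «tilted NTF» instance `h = 1_𝓜`, `u = 1_A − 1_B` of
MEMO-35 §4. [cite: Rothvoss2017, §2 and Lemma 7 (PDF pp. 6–8)] [cite: KeevashLifshitz2023, Thm. 1.8] [cite: Grigoriev2001, Lemma 1.4 (PDF p. 8)] -/
theorem scalarTilt_perCut_decay :
    ∃ a : ℝ, 0 < a ∧ ∃ n₁ : ℕ, ∀ n : ℕ, n₁ ≤ n → Even n → ∀ (t : ℕ) (C : Finset ℕ) (w : ℕ → ℝ),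
      IsBalancedDesign n t (Tq n) (dq n) 20 C w → ∀ (u : Fin n → ℝ), (∀ p, |u p| ≤ 1) → ∀ (h : PMatch n → ℝ), (∀ M, |h M| ≤ 1) →
        ∑ U : OddSet n, max (∑ M : PMatch n, levelWeight n t C w U M *
          (∑ p, (h M * u p) * ((if p ∈ U.1 then (1 : ℝ) else 0) * (if M.2.partner p ∈ U.1 then (1 : ℝ) else 0))) ^ 2) 0 ≤
        (n : ℝ) ^ 2 * (20 * Real.exp (-(a * (dq n : ℝ)))) +
          3 * (n : ℝ) ^ 4 * (20 * Real.sqrt (∏ i ∈ range ((dq n - 4) / 2 + 1), ((2 * i + 1 : ℝ) / ((n : ℝ) - 2 * i)))) := by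
  obtain ⟨a, ha, n₁, hrung⟩ := rectangleDecayExp_all_holds
  refine ⟨a, ha, max n₁ 256, fun n hn hev t C w hdes u hu h hh => ?_⟩
  have hn₁ : n₁ ≤ n := le_trans (le_max_left _ _) hn
  have hn256 : 256 ≤ n := le_trans (le_max_right _ _) hn
  have hR := hrung n hn₁ hev t C w hdes
  have hex : IsExactDesign n t (Tq n) (dq n) 20 C w := hdes.1
  obtain ⟨c', hc'⟩ := hex.1
  subst hc'
  obtain ⟨hD4, hDc⟩ := dq_bounds hn256 hex.2.2.1
  have hvar : ∑ c ∈ C, |w c| ≤ 20 := hex.2.2.2.2.2.2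
  have h1 := perCut_posPart_scalarTilt_le hev hex hDc hD4 hR u hu h hh
  refine h1.trans (add_le_add le_rfl ?_)
  exact mul_le_mul_of_nonneg_left (mul_le_mul_of_nonneg_right hvar (Real.sqrt_nonneg _)) (by positivity)

/-- **FINITE DIRECTION MENUS — UNCONDITIONAL DECAY for the crux's designs**: the same with `v_M = c(M)·u^{ι(M)}`, at the price `|κ|×`.
[cite: Rothvoss2017, §2 and Lemma 7 (PDF pp. 6–8)] [cite: KeevashLifshitz2023, Thm. 1.8] -/
theorem menu_perCut_decay :
    ∃ a : ℝ, 0 < a ∧ ∃ n₁ : ℕ, ∀ n : ℕ, n₁ ≤ n → Even n → ∀ (t : ℕ) (C : Finset ℕ) (w : ℕ → ℝ),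
      IsBalancedDesign n t (Tq n) (dq n) 20 C w → ∀ (N : ℕ) (ι : PMatch n → Fin N) (u : Fin N → Fin n → ℝ), (∀ i p, |u i p| ≤ 1) →
        ∀ (c : PMatch n → ℝ), (∀ M, |c M| ≤ 1) →
        ∑ U : OddSet n, max (∑ M : PMatch n, levelWeight n t C w U M *
          (∑ p, (c M * u (ι M) p) * ((if p ∈ U.1 then (1 : ℝ) else 0) * (if M.2.partner p ∈ U.1 then (1 : ℝ) else 0))) ^ 2) 0 ≤
        (N : ℝ) * ((n : ℝ) ^ 2 * (20 * Real.exp (-(a * (dq n : ℝ)))) +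
          3 * (n : ℝ) ^ 4 * (20 * Real.sqrt (∏ i ∈ range ((dq n - 4) / 2 + 1), ((2 * i + 1 : ℝ) / ((n : ℝ) - 2 * i))))) := by
  obtain ⟨a, ha, n₁, hrung⟩ := rectangleDecayExp_all_holds
  refine ⟨a, ha, max n₁ 256, fun n hn hev t C w hdes N ι u hu c hc => ?_⟩
  have hn₁ : n₁ ≤ n := le_trans (le_max_left _ _) hn
  have hn256 : 256 ≤ n := le_trans (le_max_right _ _) hn
  have hR := hrung n hn₁ hev t C w hdes
  have hex : IsExactDesign n t (Tq n) (dq n) 20 C w := hdes.1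
  obtain ⟨c', hc'⟩ := hex.1
  subst hc'
  obtain ⟨hD4, hDc⟩ := dq_bounds hn256 hex.2.2.1
  have hvar : ∑ c ∈ C, |w c| ≤ 20 := hex.2.2.2.2.2.2
  have h1 := perCut_posPart_menu_le hev hex hDc hD4 hR ι u hu c hc
  rw [Fintype.card_fin] at h1
  refine h1.trans (mul_le_mul_of_nonneg_left (add_le_add le_rfl ?_) (Nat.cast_nonneg _))
  exact mul_le_mul_of_nonneg_left (mul_le_mul_of_nonneg_right hvar (Real.sqrt_nonneg _)) (by positivity)

/-- **(CG_1′) FOR SCALAR TILTS OF A FIXED DIRECTION, EVERY MASK — UNCONDITIONAL DECAY for the crux's designs.**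
[cite: Rothvoss2017, §2 and Lemma 7 (PDF pp. 6–8)] [cite: KeevashLifshitz2023, Thm. 1.8] [cite: GriblingDelaatLaurent2019, §5] -/
theorem scalarTilt_perM_decay :
    ∃ a : ℝ, 0 < a ∧ ∃ n₁ : ℕ, ∀ n : ℕ, n₁ ≤ n → Even n → ∀ (t : ℕ) (C : Finset ℕ) (w : ℕ → ℝ),
      IsBalancedDesign n t (Tq n) (dq n) 20 C w → ∀ (f : OddSet n → ℝ) (G : ℝ), (∀ U, 0 ≤ f U) → (∀ U, f U ≤ G) →
        ∀ (u : Fin n → ℝ), (∀ p, |u p| ≤ 1) → ∀ (h : PMatch n → ℝ), (∀ M, |h M| ≤ 1) →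
        ∑ M : PMatch n, max (∑ U : OddSet n, levelWeight n t C w U M *
          (f U * (∑ p, (h M * u p) * ((if p ∈ U.1 then (1 : ℝ) else 0) * (if M.2.partner p ∈ U.1 then (1 : ℝ) else 0))) ^ 2)) 0 ≤
        G * ((n : ℝ) ^ 2 * (20 * Real.exp (-(a * (dq n : ℝ)))) +
          3 * (n : ℝ) ^ 4 * (20 * Real.sqrt (∏ i ∈ range ((dq n - 4) / 2 + 1), ((2 * i + 1 : ℝ) / ((n : ℝ) - 2 * i))))) := by
  obtain ⟨a, ha, n₁, hrung⟩ := rectangleDecayExp_all_holds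
  refine ⟨a, ha, max n₁ 256, fun n hn hev t C w hdes f G hf0 hfG u hu h hh => ?_⟩
  have hn₁ : n₁ ≤ n := le_trans (le_max_left _ _) hn
  have hn256 : 256 ≤ n := le_trans (le_max_right _ _) hn
  have hR := hrung n hn₁ hev t C w hdes
  have hex : IsExactDesign n t (Tq n) (dq n) 20 C w := hdes.1
  obtain ⟨c', hc'⟩ := hex.1
  subst hc'
  obtain ⟨hD4, hDc⟩ := dq_bounds hn256 hex.2.2.1
  have hvar : ∑ c ∈ C, |w c| ≤ 20 := hex.2.2.2.2.2.2
  -- a `t`-cut exists, so `0 ≤ G`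
  obtain ⟨c₀, hc₀⟩ : C.Nonempty := by
    by_contra hC
    rw [not_nonempty_iff_eq_empty] at hC
    have := hex.2.2.2.2.1
    rw [hC, sum_empty] at this
    exact zero_ne_one this
  obtain ⟨q₀, hq₀⟩ := (hex.2.2.2.1 c₀ hc₀).2.2.2
  have hG : 0 ≤ G := (hf0 q₀.1).trans (hfG q₀.1)
  have h1 := sum_posPart_perM_scalarTilt_le hev hex hDc hD4 hR f hG hf0 hfG u hu h hh
  refine h1.trans (mul_le_mul_of_nonneg_left (add_le_add le_rfl ?_) hG)
  exact mul_le_mul_of_nonneg_left (mul_le_mul_of_nonneg_right hvar (Real.sqrt_nonneg _)) (by positivity)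

end Summit.PneNP.PneNP.Theorems.ChebyshevTracialDesignScalarTiltFixedDirectionDecay
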